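import Summits.QuantumFields.YangMills.Theorems.LuscherReductionTwistedTraceScalingMultiScaleEntropy
import HarnessLib

/-!
# `TwistedTraceScaling` (stmt-QuantumFields-20203, route `LuscherReduction`, open stub `stub_cmpTwoLoop` ≡ LIM): prover-side support, part 2 —
# `M`-ADIC multi-scale entropy bounds and the THRESHOLD-FREE summability of temporally WRAPPING large-field polymers on the femto window

HONEST FRAMING: `--supports` helper for the OPEN crux `TwistedTraceScaling` (femto rung R2b1 of the CONDITIONAL reduction route `LuscherReduction`); elementary
real analysis on the tree's window labels, continuing ✓`…MultiScaleEntropy` (part 1: scale covariance `x(ℓ) = x(L) + 2b₀ log(L/ℓ)` of the running label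
`x(ℓ) = invRunningCoupling β ℓ`, scale-invariant entropy threshold `2/b₀`, dyadic union bounds UV-dominated below ∕ IR-anchored above).  It proves nothing about
Yang–Mills measures, closes no stub, and is not a mass-gap or Clay statement.  No definition, no `Theses` import, no `sorry`.

* §6 `M`-ADIC BLOCKINGS (any block factor `M ≥ 2`, as in Bałaban's `L^k` and the `M` of `Stmt.stub_cmpTwoLoop`): `madic_geom_le`, `madicSum_ge_cutoff`,
  `madicSum_unbounded_below` (below `2/b₀`: unbounded along the window for every `M` and every number of scales), `madicSum_le_above` ∕ `madicSum_le_exp_depth`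
  (above `2/b₀`: `Σ_{j ≤ J} (L/M^j)⁴e^{−δx(M^j)} ≤ e^{−δ/(8lam³)}/(1 − M^{−(2b₀δ−4)})` on `W(lam, L)`, `M^J ≤ L`, UNIFORMLY IN `L`).
* §7 ★★ TEMPORALLY WRAPPING POLYMERS ARE THRESHOLD-FREE: a polymer wrapping the time direction of the femto torus `L³ × T` at scale `ℓ = 2^j` costs `e^{−κT/ℓ}`
  (length `T/ℓ` blocks at `e^{−κ}` each, path entropy absorbed in `κ`) against only `(L/ℓ)³` transverse positions; with the femto aspect ratio `T/L = σ ≥ s/(2lam)`: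
  `Σ_{j ≤ J} (L/2^j)³e^{−κT/2^j} ≤ 48/(κσ)⁴` for EVERY `κ > 0` (`wrappingSum_le`; `y³e^{−cy} ≤ 24/(c⁴y)` and `Σ 2^j/L ≤ 2`), on the window
  `≤ 48(2lam/(κs))⁴ = 768 lam⁴/(κs)⁴` (`wrappingSum_le_of_window`, `wrapping_constant_eq`) — UNIFORM IN `L`, polynomially small in the depth, NO threshold.
  This is the crux's informal clause «temporally wrapping large-field polymers at scale `2^j` contribute `(L/2^j)³e^{−κT/2^j}`, summable uniformly in `L` since
  `T/L = s/Λ`» as a tree lemma; contrast part 1 §3–§5: LOCAL (non-wrapping) defects are charged against the 4-volume and DO carry the threshold `2/b₀`.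

READING (constraint on proofs; refutes nothing): in an `L`-uniform multi-scale supplier of CMP-2LOOP ∕ LIM the only globally excludable events are (i) local defects
charged `> (2/b₀)/ḡ²(ℓa)` per `ℓ`-block and (ii) time-wrapping polymers at any positive cost per block; everything else is polymer-local bookkeeping.
-/

set_option autoImplicit false

noncomputable section

open MeasureTheory Filter Topology Real
open Literature.MathematicalPhysics.QuantumFieldTheory hiding SU2
open Literature.MathematicalPhysics.QuantumLattice
open Literature.Analysis.OperatorTheory.YMMatrixModel
open scoped BigOperators

namespace Summit.QuantumFields.YangMills.Theorems.FemtoTransferGap.MultiScaleEntropy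

open Summit.QuantumFields.YangMills.Theorems.FemtoTransferGap
open Summit.QuantumFields.YangMills.Theorems.FemtoTransferGap.TraceDoor
open Summit.QuantumFields.YangMills.Theorems.TwistedTraceScaling.Negative

/-! ## §6 `M`-adic blockings (any block factor `M ≥ 2`, as in Bałaban's `L^k` and in `Stmt.stub_cmpTwoLoop`'s `M`)

The dyadic statements of §3–§4 with `2` replaced by a natural block factor `M ≥ 2`: the cutoff term is the same, so the below-threshold side is unchanged;
above threshold the geometric constant becomes `1/(1 − M^{−(2b₀δ−4)})`. -/

/-- Geometric bookkeeping, `M`-adic: for `η > 0`, `M ≥ 2` and `M^J ≤ L`, `Σ_{j ≤ J} (M^j/L)^η ≤ 1/(1 − M^{−η})`. [folklore] -/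
theorem madic_geom_le {η : ℝ} (hη : 0 < η) {M L J : ℕ} (hM : 2 ≤ M) (hL : 0 < L) (hJ : M ^ J ≤ L) :
    ∑ j ∈ Finset.range (J + 1), ((M : ℝ) ^ j / L) ^ η ≤ 1 / (1 - (M : ℝ) ^ (-η)) := by
  have hLr : (0 : ℝ) < L := by exact_mod_cast hL
  have hM1 : (1 : ℝ) < M := by exact_mod_cast (lt_of_lt_of_le (by norm_num) hM : 1 < M)
  have hM0 : (0 : ℝ) < M := by linarith
  have hr0 : 0 < (M : ℝ) ^ (-η) := Real.rpow_pos_of_pos hM0 _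
  have hr1 : (M : ℝ) ^ (-η) < 1 := Real.rpow_lt_one_of_one_lt_of_neg hM1 (by linarith)
  have haux : ∀ n : ℕ, (((M : ℝ) ^ n)⁻¹) ^ η = ((M : ℝ) ^ (-η)) ^ n := by
    intro n
    rw [Real.inv_rpow (by positivity), ← Real.rpow_natCast (M : ℝ) n, ← Real.rpow_mul hM0.le,
      ← Real.rpow_natCast ((M : ℝ) ^ (-η)) n, ← Real.rpow_mul hM0.le, ← Real.rpow_neg hM0.le]
    congr 1
    ring
  have hterm : ∀ j ∈ Finset.range (J + 1), ((M : ℝ) ^ j / L) ^ η ≤ ((M : ℝ) ^ (-η)) ^ (J - j) := by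
    intro j hj
    have hjJ : j ≤ J := Nat.lt_succ_iff.mp (Finset.mem_range.mp hj)
    have hMJ : ((M : ℝ) ^ J) ≤ L := by exact_mod_cast hJ
    have hJ' : (M : ℝ) ^ J = M ^ j * M ^ (J - j) := by rw [← pow_add, Nat.add_sub_cancel' hjJ]
    have hq : (M : ℝ) ^ j / L ≤ ((M : ℝ) ^ (J - j))⁻¹ := by
      calc (M : ℝ) ^ j / L ≤ (M : ℝ) ^ j / M ^ J := div_le_div_of_nonneg_left (by positivity) (by positivity) hMJ
        _ = ((M : ℝ) ^ (J - j))⁻¹ := by rw [hJ']; field_simp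
    calc ((M : ℝ) ^ j / L) ^ η ≤ (((M : ℝ) ^ (J - j))⁻¹) ^ η := Real.rpow_le_rpow (by positivity) hq hη.le
      _ = ((M : ℝ) ^ (-η)) ^ (J - j) := haux (J - j)
  calc ∑ j ∈ Finset.range (J + 1), ((M : ℝ) ^ j / L) ^ η
      ≤ ∑ j ∈ Finset.range (J + 1), ((M : ℝ) ^ (-η)) ^ (J - j) := Finset.sum_le_sum hterm
    _ = ∑ i ∈ Finset.range (J + 1), ((M : ℝ) ^ (-η)) ^ i := by
        rw [← Finset.sum_range_reflect]
        refine Finset.sum_congr rfl fun i hi => ?_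
        have hiJ : i ≤ J := Nat.lt_succ_iff.mp (Finset.mem_range.mp hi)
        congr 1
        omega
    _ ≤ ∑' i : ℕ, ((M : ℝ) ^ (-η)) ^ i :=
        Summable.sum_le_tsum _ (fun i _ => by positivity) (summable_geometric_of_lt_one hr0.le hr1)
    _ = 1 / (1 - (M : ℝ) ^ (-η)) := by rw [tsum_geometric_of_lt_one hr0.le hr1, one_div]

/-- Every `M`-adic multi-scale sum dominates its cutoff term. [folklore] -/
theorem madicSum_ge_cutoff (β δ : ℝ) (M L J : ℕ) :
    (L : ℝ) ^ 4 * Real.exp (-(δ * invRunningCoupling β 1))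
      ≤ ∑ j ∈ Finset.range (J + 1), ((L : ℝ) / M ^ j) ^ 4 * Real.exp (-(δ * invRunningCoupling β (M ^ j))) := by
  have h0 : 0 ∈ Finset.range (J + 1) := Finset.mem_range.2 (Nat.succ_pos J)
  have := Finset.single_le_sum (f := fun j => ((L : ℝ) / M ^ j) ^ 4 * Real.exp (-(δ * invRunningCoupling β (M ^ j))))
    (fun j _ => by positivity) h0
  simpa using this

/-- ★ **Below threshold, `M`-adic**: for `0 ≤ δ < 2/b₀`, any block factor `M` and any number of scales, the `M`-adic multi-scale union bound is unbounded along
`W(lam, L)`. [folklore] -/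
theorem madicSum_unbounded_below {δ lam : ℝ} (hδ0 : 0 ≤ δ) (hδ : δ < 2 / b0) (hlam : 0 < lam) (M' : ℝ) (M : ℕ) :
    ∃ L1 : ℕ, ∀ (L : ℕ) [NeZero L], L1 ≤ L → ∀ β : ℝ, InFemtoWindow lam β L → ∀ J : ℕ,
      M' ≤ ∑ j ∈ Finset.range (J + 1), ((L : ℝ) / M ^ j) ^ 4 * Real.exp (-(δ * invRunningCoupling β (M ^ j))) := by
  obtain ⟨L1, hL1⟩ := cutoffWeight_unbounded_below hδ0 hδ hlam M'
  exact ⟨L1, fun L _ hL β hW J => (hL1 L hL β hW).trans (madicSum_ge_cutoff β δ M L J)⟩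

/-- ★★ **Above threshold, `M`-adic, IR-anchored**: for `2b₀δ > 4`, `M ≥ 2` and `M^J ≤ L`,
`Σ_{j ≤ J} (L/M^j)⁴ e^{−δ/ḡ²(M^j a)} ≤ e^{−δ/ḡ²(La)}/(1 − M^{−(2b₀δ − 4)})`, every `L` and `β`. [folklore] -/
theorem madicSum_le_above {β δ : ℝ} (hδ : 4 < 2 * b0 * δ) {M L J : ℕ} (hM : 2 ≤ M) (hL : 0 < L) (hJ : M ^ J ≤ L) :
    ∑ j ∈ Finset.range (J + 1), ((L : ℝ) / M ^ j) ^ 4 * Real.exp (-(δ * invRunningCoupling β (M ^ j)))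
      ≤ Real.exp (-(δ * invRunningCoupling β L)) / (1 - (M : ℝ) ^ (-(2 * b0 * δ - 4))) := by
  have hη : 0 < 2 * b0 * δ - 4 := by linarith
  have hLr : (0 : ℝ) < L := by exact_mod_cast hL
  have hM0 : 0 < M := lt_of_lt_of_le (by norm_num) hM
  have hrw : ∀ j ∈ Finset.range (J + 1),
      ((L : ℝ) / M ^ j) ^ 4 * Real.exp (-(δ * invRunningCoupling β (M ^ j)))
        = Real.exp (-(δ * invRunningCoupling β L)) * (((M : ℝ) ^ j / L) ^ (2 * b0 * δ - 4)) := by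
    intro j _
    have hMj : 0 < M ^ j := pow_pos hM0 j
    have h := scaleWeight_eq β δ hMj hL
    push_cast at h ⊢
    rw [h, mul_comm]
    congr 1
    have hq : (0 : ℝ) < (L : ℝ) / M ^ j := by positivity
    rw [show ((M : ℝ) ^ j / L) = ((L : ℝ) / M ^ j)⁻¹ by rw [inv_div], Real.inv_rpow hq.le, ← Real.rpow_neg hq.le]
    ring_nf
  rw [Finset.sum_congr rfl hrw, ← Finset.mul_sum, div_eq_mul_one_div]
  exact mul_le_mul_of_nonneg_left (madic_geom_le hη hM hL hJ) (Real.exp_pos _).le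

/-- ★★ **… hence bounded UNIFORMLY IN `L` by the depth, `M`-adic**: for `2b₀δ > 4`, `δ ≥ 0`, `M ≥ 2`, on `W(lam, L)` and `M^J ≤ L`,
`Σ_{j ≤ J} (L/M^j)⁴ e^{−δ/ḡ²(M^j a)} ≤ e^{−δ/(8lam³)}/(1 − M^{−(2b₀δ−4)})`. [folklore] -/
theorem madicSum_le_exp_depth {β δ lam : ℝ} (hδ : 4 < 2 * b0 * δ) (hδ0 : 0 ≤ δ) (hlam : 0 < lam) {M L J : ℕ} (hM : 2 ≤ M)
    (hW : InFemtoWindow lam β L) (hL : 0 < L) (hJ : M ^ J ≤ L) :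
    ∑ j ∈ Finset.range (J + 1), ((L : ℝ) / M ^ j) ^ 4 * Real.exp (-(δ * invRunningCoupling β (M ^ j)))
      ≤ Real.exp (-(δ / (8 * lam ^ 3))) / (1 - (M : ℝ) ^ (-(2 * b0 * δ - 4))) := by
  have hη : 0 < 2 * b0 * δ - 4 := by linarith
  have hM1 : (1 : ℝ) < M := by exact_mod_cast (lt_of_lt_of_le (by norm_num) hM : 1 < M)
  have hr1 : (M : ℝ) ^ (-(2 * b0 * δ - 4)) < 1 := Real.rpow_lt_one_of_one_lt_of_neg hM1 (by linarith)
  refine (madicSum_le_above hδ hM hL hJ).trans ?_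
  apply div_le_div_of_nonneg_right _ (by linarith)
  rw [Real.exp_le_exp]
  have hx := invRunningCoupling_ge_of_window hlam hW
  have : δ * (1 / (8 * lam ^ 3)) ≤ δ * invRunningCoupling β L := mul_le_mul_of_nonneg_left hx hδ0
  have h8 : δ * (1 / (8 * lam ^ 3)) = δ / (8 * lam ^ 3) := by ring
  linarith

/-! ## §7 Temporally WRAPPING large-field polymers are threshold-free: length cost against 3-volume entropy

A polymer wrapping the time direction of the femto torus `L³ × T` at blocking scale `ℓ = 2^j` is a chain of `≥ T/ℓ` blocks; if each block (path entropy
included) costs `e^{−κ}`, the polymer costs `e^{−κT/ℓ}` and there are `(L/ℓ)³` transverse starting positions.  With the femto aspect ratio `T/L = σ ≥ s/(2lam)`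
(`T = T_s = ⌈sL/Λ⌉`, `Λ ≤ 2lam`) the sum over ALL scales is `≤ 48/(κσ)⁴`, UNIFORMLY IN `L`, with NO threshold on `κ > 0` — the crux's informal clause
«temporally wrapping large-field polymers at scale `2^j` contribute `(L/2^j)³e^{−κT/2^j}`, summable uniformly in `L` since `T/L = s/Λ`» as a tree lemma.
Contrast §3–§5: local (non-wrapping) defects are charged against the 4-volume and DO have the threshold `2/b₀`. -/

/-- `y³ e^{−c y} ≤ 24/(c⁴ y)` for `c, y > 0` (`e^{cy} ≥ (cy)⁴/4!`). [folklore] -/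
theorem cube_mul_exp_neg_le {c y : ℝ} (hc : 0 < c) (hy : 0 < y) :
    y ^ 3 * Real.exp (-(c * y)) ≤ 24 / (c ^ 4 * y) := by
  have hcy : 0 ≤ c * y := by positivity
  have h4 := Real.pow_div_factorial_le_exp (c * y) hcy 4
  have hfac : ((4 : ℕ).factorial : ℝ) = 24 := by norm_num [Nat.factorial]
  rw [hfac] at h4
  rw [Real.exp_neg, ← div_eq_mul_inv, div_le_div_iff₀ (Real.exp_pos _) (by positivity)]
  -- y³ · (c⁴ y) ≤ 24 · e^{cy}
  have h5 : (c * y) ^ 4 ≤ 24 * Real.exp (c * y) := by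
    rw [div_le_iff₀ (by norm_num : (0 : ℝ) < 24)] at h4
    linarith
  nlinarith [h5]

/-- Dyadic counting: `Σ_{j ≤ J} 2^j/L ≤ 2` when `2^J ≤ L`. [folklore] -/
theorem dyadic_inv_sum_le_two {L J : ℕ} (hL : 0 < L) (hJ : 2 ^ J ≤ L) :
    ∑ j ∈ Finset.range (J + 1), (2 : ℝ) ^ j / L ≤ 2 := by
  have hLr : (0 : ℝ) < L := by exact_mod_cast hL
  have h2J : ((2 : ℝ) ^ J) ≤ L := by exact_mod_cast hJ
  rw [← Finset.sum_div, div_le_iff₀ hLr]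
  have hgeom : ∑ j ∈ Finset.range (J + 1), (2 : ℝ) ^ j = 2 ^ (J + 1) - 1 := by
    have := geom_sum_eq (show (2 : ℝ) ≠ 1 by norm_num) (J + 1)
    rw [this]
    norm_num
  rw [hgeom, pow_succ]
  nlinarith

/-- ★★ **Wrapping polymers are `L`-uniformly summable at every positive cost** (aspect-ratio form): for `κ > 0`, `σ > 0`, a real time extent `T ≥ σL` and
`2^J ≤ L`, `Σ_{j ≤ J} (L/2^j)³ e^{−κT/2^j} ≤ 48/(κσ)⁴`. [folklore] -/
theorem wrappingSum_le {κ σ T : ℝ} (hκ : 0 < κ) (hσ : 0 < σ) {L J : ℕ} (hL : 0 < L) (hT : σ * L ≤ T) (hJ : 2 ^ J ≤ L) :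
    ∑ j ∈ Finset.range (J + 1), ((L : ℝ) / 2 ^ j) ^ 3 * Real.exp (-(κ * T / 2 ^ j)) ≤ 48 / (κ * σ) ^ 4 := by
  have hLr : (0 : ℝ) < L := by exact_mod_cast hL
  set c : ℝ := κ * T / L with hc
  have hTpos : 0 < T := lt_of_lt_of_le (by positivity) hT
  have hcpos : 0 < c := by positivity
  have hcge : κ * σ ≤ c := by
    rw [hc, le_div_iff₀ hLr]
    nlinarith [mul_le_mul_of_nonneg_left hT hκ.le]
  -- each term ≤ 24/(c⁴ y_j) = (24/c⁴) · (2^j/L)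
  have hterm : ∀ j ∈ Finset.range (J + 1),
      ((L : ℝ) / 2 ^ j) ^ 3 * Real.exp (-(κ * T / 2 ^ j)) ≤ (24 / c ^ 4) * ((2 : ℝ) ^ j / L) := by
    intro j _
    have hy : (0 : ℝ) < (L : ℝ) / 2 ^ j := by positivity
    have hexp : κ * T / 2 ^ j = c * ((L : ℝ) / 2 ^ j) := by
      rw [hc]; field_simp
    rw [hexp]
    refine (cube_mul_exp_neg_le hcpos hy).trans (le_of_eq ?_)
    field_simp
  calc ∑ j ∈ Finset.range (J + 1), ((L : ℝ) / 2 ^ j) ^ 3 * Real.exp (-(κ * T / 2 ^ j))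
      ≤ ∑ j ∈ Finset.range (J + 1), (24 / c ^ 4) * ((2 : ℝ) ^ j / L) := Finset.sum_le_sum hterm
    _ = (24 / c ^ 4) * ∑ j ∈ Finset.range (J + 1), (2 : ℝ) ^ j / L := by rw [Finset.mul_sum]
    _ ≤ (24 / c ^ 4) * 2 := mul_le_mul_of_nonneg_left (dyadic_inv_sum_le_two hL hJ) (by positivity)
    _ = 48 / c ^ 4 := by ring
    _ ≤ 48 / (κ * σ) ^ 4 := by
        apply div_le_div_of_nonneg_left (by norm_num) (by positivity)
        exact pow_le_pow_left₀ (by positivity) hcge 4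

/-- ★★ **Femto-window form**: on `W(lam, L)` with `s > 0`, `κ > 0` and `2^J ≤ L`, the wrapping-polymer sum at the femto time extent `T_s = ⌈sL/Λ⌉`
obeys `Σ_{j ≤ J} (L/2^j)³ e^{−κT_s/2^j} ≤ 48·(2lam/(κs))⁴ = 768 lam⁴/(κs)⁴` — UNIFORM IN `L`, polynomially small in the depth, no threshold on `κ`.
[folklore] -/
theorem wrappingSum_le_of_window {κ s lam β : ℝ} (hκ : 0 < κ) (hs : 0 < s) (hlam : 0 < lam) {L J : ℕ} [NeZero L]
    (hW : InFemtoWindow lam β L) (hJ : 2 ^ J ≤ L) :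
    ∑ j ∈ Finset.range (J + 1), ((L : ℝ) / 2 ^ j) ^ 3 * Real.exp (-(κ * (femtoSteps s β L : ℝ) / 2 ^ j))
      ≤ 48 / (κ * (s / (2 * lam))) ^ 4 := by
  have hL : 0 < L := Nat.pos_of_ne_zero (NeZero.ne L)
  have hT := R80.femtoSteps_ge_of_window hs.le hlam hW
  have hT' : s / (2 * lam) * L ≤ (femtoSteps s β L : ℝ) := by
    have : s / (2 * lam) * L = s * L / (2 * lam) := by ring
    linarith
  exact wrappingSum_le hκ (by positivity) hL hT' hJ

/-- The constant spelled out: `48/(κ s/(2lam))⁴ = 768 lam⁴/(κ s)⁴`. [folklore] -/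
theorem wrapping_constant_eq {κ s lam : ℝ} (hκ : 0 < κ) (hs : 0 < s) (hlam : 0 < lam) :
    48 / (κ * (s / (2 * lam))) ^ 4 = 768 * lam ^ 4 / (κ * s) ^ 4 := by
  have h1 : κ ≠ 0 := hκ.ne'
  have h2 : s ≠ 0 := hs.ne'
  have h3 : lam ≠ 0 := hlam.ne'
  field_simp
  ring

end Summit.QuantumFields.YangMills.Theorems.FemtoTransferGap.MultiScaleEntropy

end
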